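import Mathlib

/-!
# `GappedShellCensus.FiveFoldRationingR`, stub P: parity of five-bonds

In an all-gapped-twelve configuration `Y ⊆ ℝ³` at scale `a > 0` every site `y` has exactly twelve
other sites within `1.02 a` (its shell `S(y)`).  For a bond `(y, v)` (`v ∈ S(y)`) the common bond
partners of `y` and `v` are exactly the shell sites `w ∈ S(y)`, `w ≠ v`, with `dist v w ≤ 1.02 a`,
so their number `deg v` is the degree of `v` in the (symmetric, loop-free) bond graph on the finite
set `S(y)`.  By the handshake identity `∑_{v ∈ S(y)} deg v` is even.  If every bond has at least
four (torn-free) and at most five (F1) common partners, then `∑ deg = 4 · #S(y) + #{v | deg v = 5}`,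
so the number of FIVE-BONDS at `y` (bonds with `≥ 5` common partners) is even: five-fold lines have
no ends.
-/

noncomputable section

namespace Summit.AtomisticToContinuum.Crystallization.Theorems

/-- Handshake parity.  For a relation `R` that is symmetric and irreflexive on a finset `T`, the sum
over `v ∈ T` of the number of elements of `T` related to `v` is even (the swap `(v, w) ↦ (w, v)` is a
fixed-point-free involution of the set of related pairs). -/
theorem ffrPar_even_sum_ncard {α : Type*} (T : Finset α) (R : α → α → Prop)
    (hsymm : ∀ v ∈ T, ∀ w ∈ T, R v w → R w v) (hirr : ∀ v ∈ T, ¬ R v v) :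
    Even (∑ v ∈ T, ({w | w ∈ T ∧ R v w} : Set α).ncard) := by
  classical
  have h1 : ∀ v, ({w | w ∈ T ∧ R v w} : Set α).ncard = (T.filter (R v)).card := by
    intro v
    rw [← Set.ncard_coe_finset]
    congr 1
    ext w
    simp
  simp_rw [h1]
  -- double count the related pairs in `ZMod 2`
  have h : ∑ p ∈ T ×ˢ T, (if R p.1 p.2 then (1 : ZMod 2) else 0) = 0 := by
    refine Finset.sum_involution (fun p _ => p.swap) ?_ ?_ ?_ ?_
    · rintro ⟨v, w⟩ hp
      rw [Finset.mem_product] at hp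
      show (if R v w then (1 : ZMod 2) else 0) + (if R w v then (1 : ZMod 2) else 0) = 0
      by_cases hvw : R v w
      · rw [if_pos hvw, if_pos (hsymm v hp.1 w hp.2 hvw)]
        decide
      · rw [if_neg hvw, if_neg (fun h => hvw (hsymm w hp.2 v hp.1 h)), add_zero]
    · rintro ⟨v, w⟩ hp hne heq
      rw [Finset.mem_product] at hp
      simp only [Prod.swap_prod_mk, Prod.mk.injEq] at heq
      apply hne
      obtain ⟨_, hvw⟩ := heq
      subst hvw
      show (if R v v then (1 : ZMod 2) else 0) = 0
      rw [if_neg (hirr v hp.1)]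
    · rintro ⟨v, w⟩ hp
      rw [Finset.mem_product] at hp ⊢
      exact ⟨hp.2, hp.1⟩
    · rintro ⟨v, w⟩ _
      rfl
  rw [Finset.sum_product] at h
  rw [← ZMod.natCast_eq_zero_iff_even]
  push_cast
  simpa only [Finset.natCast_card_filter] using h

/-- If every value `d v`, `v ∈ T`, is `4` or `5` and `∑_{v ∈ T} d v` is even, then the number of
`v ∈ T` with `5 ≤ d v` is even. -/
theorem ffrPar_even_card_filter_five {α : Type*} (T : Finset α) (d : α → ℕ)
    (h4 : ∀ v ∈ T, 4 ≤ d v) (h5 : ∀ v ∈ T, d v ≤ 5) (hsum : Even (∑ v ∈ T, d v)) :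
    Even (T.filter (fun v => 5 ≤ d v)).card := by
  have key : ∑ v ∈ T, d v = ∑ v ∈ T, (4 + if 5 ≤ d v then 1 else 0) := by
    refine Finset.sum_congr rfl fun v hv => ?_
    have h4v := h4 v hv
    have h5v := h5 v hv
    split_ifs with h <;> omega
  rw [key, Finset.sum_add_distrib, Finset.sum_const, smul_eq_mul, ← Finset.card_filter] at hsum
  have h4e : Even (T.card * 4) := ⟨T.card * 2, by ring⟩
  exact (Nat.even_add.mp hsum).mp h4e

/-- The parity statement at one site, for a general (pseudo)metric space: if `T` enumerates the shell
`{w ∈ Y | w ≠ y ∧ dist y w ≤ r}` of `y` and every bond `(y, v)`, `v` in the shell, has at least four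
and at most five common partners, then the number of shell sites `v` whose bond `(y, v)` has at least
five common partners is even. -/
theorem ffrPar_even_of_shell {α : Type*} [PseudoMetricSpace α] (Y : Set α) (r : ℝ) (y : α)
    (T : Finset α) (hT : ∀ w, w ∈ T ↔ w ∈ Y ∧ w ≠ y ∧ dist y w ≤ r)
    (h4 : ∀ v ∈ Y, v ≠ y → dist y v ≤ r →
      4 ≤ {w ∈ Y | w ≠ y ∧ w ≠ v ∧ dist y w ≤ r ∧ dist v w ≤ r}.ncard)
    (h5 : ∀ v ∈ Y, v ≠ y → dist y v ≤ r →
      {w ∈ Y | w ≠ y ∧ w ≠ v ∧ dist y w ≤ r ∧ dist v w ≤ r}.ncard ≤ 5) :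
    Even {v ∈ Y | v ≠ y ∧ dist y v ≤ r ∧
      5 ≤ {w ∈ Y | w ≠ y ∧ w ≠ v ∧ dist y w ≤ r ∧ dist v w ≤ r}.ncard}.ncard := by
  -- the target set is a filter of the shell finset `T`
  have hF : {v ∈ Y | v ≠ y ∧ dist y v ≤ r ∧
        5 ≤ {w ∈ Y | w ≠ y ∧ w ≠ v ∧ dist y w ≤ r ∧ dist v w ≤ r}.ncard}
      = ↑(T.filter (fun v => 5 ≤ {w ∈ Y | w ≠ y ∧ w ≠ v ∧ dist y w ≤ r ∧ dist v w ≤ r}.ncard)) := by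
    ext v
    simp only [Set.mem_setOf_eq, Finset.coe_filter, hT]
    tauto
  rw [hF, Set.ncard_coe_finset]
  refine ffrPar_even_card_filter_five T
    (fun v => {w ∈ Y | w ≠ y ∧ w ≠ v ∧ dist y w ≤ r ∧ dist v w ≤ r}.ncard) ?_ ?_ ?_
  · intro v hv
    obtain ⟨hvY, hvy, hvd⟩ := (hT v).1 hv
    exact h4 v hvY hvy hvd
  · intro v hv
    obtain ⟨hvY, hvy, hvd⟩ := (hT v).1 hv
    exact h5 v hvY hvy hvd
  · -- for `v` in the shell, the common partners of `(y, v)` are the shell sites bonded to `v`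
    have hC : ∀ v ∈ T, {w ∈ Y | w ≠ y ∧ w ≠ v ∧ dist y w ≤ r ∧ dist v w ≤ r}
        = ({w | w ∈ T ∧ (w ≠ v ∧ dist v w ≤ r)} : Set α) := by
      intro v _
      ext w
      simp only [Set.mem_setOf_eq, hT]
      tauto
    have hsum : ∑ v ∈ T, {w ∈ Y | w ≠ y ∧ w ≠ v ∧ dist y w ≤ r ∧ dist v w ≤ r}.ncard
        = ∑ v ∈ T, ({w | w ∈ T ∧ (w ≠ v ∧ dist v w ≤ r)} : Set α).ncard :=
      Finset.sum_congr rfl fun v hv => by rw [hC v hv]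
    show Even (∑ v ∈ T, {w ∈ Y | w ≠ y ∧ w ≠ v ∧ dist y w ≤ r ∧ dist v w ≤ r}.ncard)
    rw [hsum]
    exact ffrPar_even_sum_ncard T (fun v w => w ≠ v ∧ dist v w ≤ r)
      (fun v _ w _ h => ⟨fun h' => h.1 h'.symm, by rw [dist_comm]; exact h.2⟩)
      (fun v _ h => h.1 rfl)

/-- **Stub P (parity of five-bonds; five-fold lines have no ends).** In an all-gapped-twelve
configuration `Y ⊆ ℝ³` at scale `a > 0` in which every bond has at least four (torn-free) and at most
five (F1) common partners, at every site `y` the number of bonds `(y, v)` with at least five common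
partners is even.  Handshake on the twelve-shell of `y`: the common partners of `(y, v)` are the shell
sites bonded to `v`, so shell degrees are `4` or `5`, their sum is even, hence the number of degree-`5`
shell sites is even. -/
theorem stub_ffrParity :
    ∀ (Y : Set (EuclideanSpace ℝ (Fin 3))) (a : ℝ), 0 < a →
      (∀ y ∈ Y, ({w ∈ Y | w ≠ y ∧ dist y w ≤ a * (1 + 1 / 50)}.ncard = 12 ∧
        ∀ w ∈ Y, w ≠ y → a * (1 - 1 / 50) ≤ dist y w ∧
          (dist y w ≤ a * (1 + 1 / 50) ∨ a * (63 / 50) ≤ dist y w))) →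
      (∀ y ∈ Y, ∀ v ∈ Y, v ≠ y → dist y v ≤ a * (1 + 1 / 50) →
        4 ≤ {w ∈ Y | w ≠ y ∧ w ≠ v ∧ dist y w ≤ a * (1 + 1 / 50) ∧ dist v w ≤ a * (1 + 1 / 50)}.ncard) →
      (∀ y ∈ Y, ∀ v ∈ Y, v ≠ y → dist y v ≤ a * (1 + 1 / 50) →
        {w ∈ Y | w ≠ y ∧ w ≠ v ∧ dist y w ≤ a * (1 + 1 / 50) ∧ dist v w ≤ a * (1 + 1 / 50)}.ncard ≤ 5) →
      ∀ y ∈ Y, Even {v ∈ Y | v ≠ y ∧ dist y v ≤ a * (1 + 1 / 50) ∧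
        5 ≤ {w ∈ Y | w ≠ y ∧ w ≠ v ∧ dist y w ≤ a * (1 + 1 / 50) ∧
          dist v w ≤ a * (1 + 1 / 50)}.ncard}.ncard := by
  intro Y a _ hgap htorn hF1 y hy
  have hfin : ({w ∈ Y | w ≠ y ∧ dist y w ≤ a * (1 + 1 / 50)}).Finite :=
    Set.finite_of_ncard_ne_zero (by rw [(hgap y hy).1]; decide)
  exact ffrPar_even_of_shell Y (a * (1 + 1 / 50)) y hfin.toFinset
    (fun w => by simp only [Set.Finite.mem_toFinset, Set.mem_setOf_eq]) (htorn y hy) (hF1 y hy)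

end Summit.AtomisticToContinuum.Crystallization.Theorems

end
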